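import Literature.Probability.FitznerVanDerHofstad2017.NobleBoundsN0
import Literature.Probability.FitznerVanDerHofstad2017.SimpleDiagramFourierBound
import Literature.Probability.FitznerVanDerHofstad2017.DoubleConnectionBubbleFourier
import Literature.Probability.FitznerVanDerHofstad2017.TwoPointSrwBound
import Literature.Barriers.CriticalPhenomena.GaussianDominationRouteLemma85
import HarnessLib

/-!
# [FvdH17] §4.2 (4.3) and the `x`-space half of (4.10): the non-repulsive simple diagrams are
# bounded by `(2dp)^{Σl} (D^{⋆Σl} ⋆ τ_p^{⋆n})(x)`, hence by the SRW integral `K_{n,Σl}(x)` — kernel proof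

Companion of `NobleBoundsN0.lean` (the events `{0 ←m→ x}` = `openConnGe`, PATH READING, and the modified
two-point function `τ_{m,p} = tauGe`), of `SimpleDiagramFourierBound.lean` (the `k`-space half), of
`TwoPointSrwBound.lean` (literature seat: the last member of (4.3), `τ_{m,p}(x) ≤ (2dp)^m (D^{⋆m} ⋆ τ_p)(x)`,
`tauGe_le_pow_mul_srwConv_tau`, IMPORTED and used here) and of `DoubleConnectionBubbleFourier.lean`
(`D^{⋆m} ⋆ D^{⋆n} = D^{⋆(m+n)}`, `convPow_srwStep_add_apply`, IMPORTED).
Everything here is PROVED; no named fact, no hypothesis beyond `p < p_c(ℤ^d)` and `d ≥ 2` (resp.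
`2n + 1 ≤ d` for the finiteness of `K_{n,m}`).

## What is proved

* **(4.3), middle member** ([FvdH17] §4.2 display (4.3), arXiv:1506.07977v2 p. 34; EJP 22 (2017)
  no. 43 p. 31): for every `m ≥ 0` and EVERY `x` (the printed restriction `x ≠ 0` is not needed under the
  path reading, both sides vanishing appropriately),
  `τ_{m+1,p}(x) ≤ 2dp · (D ⋆ τ_{m,p})(x)` (`tauGe_succ_le_srwStep_conv`): the BK inequality applied to
  "the first bond of the path is open" `□` "`{y ←m→ x}`" (the remaining `≥ m` bonds form an open simple path
  from the neighbour `y` of `0`, edge-disjoint from the first bond), summed over the `2d` neighbours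
  (`exists_first_bond_of_mem_openConnGe`, `bk_finitary`, `bondPercolation_cylinder`).  The LAST member of (4.3),
  `τ_{m,p}(x) ≤ (2dp)^m (D^{⋆m} ⋆ τ_p)(x)`, is the literature seat's `tauGe_le_pow_mul_srwConv_tau`
  (`TwoPointSrwBound.lean`, via the trail extraction (4.18)); it is imported, not re-proved.
* **The non-repulsive diagrams (4.5)–(4.8) summed over all but the last vertex** are the iterated
  convolutions `nonRepDiagram d p [l₁, …, l_n] = τ_{l₁,p} ⋆ ⋯ ⋆ τ_{l_n,p}` (definition + the unfolded
  forms `nonRepDiagram_pair_eq_tsum`, `nonRepDiagram_triple_eq_tsum` = `Σ_{x₁} 𝓑*` and `Σ_{x₁,x₂} 𝓣*`).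
* **(4.10), first inequality** ([FvdH17] p. 35; [NoBLE17] §5.3.2 first display, PTRF 169 (2017) p. 1097,
  first inequality): `(τ_{l₁} ⋆ ⋯ ⋆ τ_{l_n})(x) ≤ (2dp)^{l} (D^{⋆l} ⋆ τ_p^{⋆n})(x)`, `l = Σ lᵢ`
  (`nonRepDiagram_le_pow_mul_srwConvTau`), via the convolution algebra of `ℓ¹ ∩ ℓ^∞` kernels
  (`latticeConv_latticeConv_comm₄` here; `convPow_srwStep_add_apply` of `DoubleConnectionBubbleFourier`).
* **Assembly with the `k`-space half**: `(τ_{l₁} ⋆ ⋯ ⋆ τ_{l_n})(x) ≤ (2dp)^l Γ̄₂ⁿ K_{n,l}(x)`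
  (`nonRepDiagram_le_srwK`) and the printed form
  `≤ ((2d/(2d−1))Γ₁)^l (((2d−2)/(2d−1))Γ₂)ⁿ K_{n,l}(x)` under `(2d−1)p ≤ Γ₁`, `f₂(p) ≤ Γ₂`
  (`nonRepDiagram_le_printed`; [FvdH17] (4.10)–(4.11) with `I_{n,l}` replaced by the tree's `K_{n,l}(x)` of
  [NoBLE17] (3.36), which dominates the printed `x`-dependent integral termwise).

NOT here: (4.4) and (4.18) (exact-length events and trail extraction — `TwoPointTrailExtraction`), the
repulsive diagrams (4.12)–(4.17) and (4.19)–(4.21), any numerical value.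

## References
* [FvdH17] R. Fitzner, R. van der Hofstad, *Mean-field behavior for nearest-neighbor percolation in `d > 10`*,
  EJP 22 (2017) no. 43, §4.2 (4.1), (4.3), (4.5)–(4.11) (arXiv:1506.07977v2 pp. 34–35) (`FitznerVanDerHofstad2017`).
* [NoBLE17] R. Fitzner, R. van der Hofstad, *Generalized approach to the non-backtracking lace expansion*,
  PTRF 169 (2017) 1041–1119, §5.3.2 first display p. 1097, (3.36) p. 1071 (`FitznerVanDerHofstad2016NoBLE`).
* J. van den Berg, H. Kesten, J. Appl. Probab. 22 (1985) 556–569 (BK inequality; tree `bk_finitary`);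
  G. Grimmett, *Percolation*, 2nd ed., Springer 1999, §2.3 (`Grimmett1999`).
-/

noncomputable section

namespace Literature.Probability.FitznerVanDerHofstad2017

open MeasureTheory Real Finset Filter
open scoped BigOperators
open Literature.Probability.LatticeModels
open Literature.Probability.Percolation
open Literature.Barriers.CriticalPhenomena
open Literature.Barriers.CriticalPhenomena.SpreadOutIsing (delta0 latticeConv convPow latticeConv_comm
  latticeConv_delta0_left latticeConv_delta0 latticeConv_assoc_of_bdd abs_latticeConv_le_of_bdd)

variable {d : ℕ}

/-! ### A. Elementary facts on `τ_{m,p}` -/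

/-- `τ_{0,p}(x) = τ_p(x)` (`{0 ←0→ x} = {0 ↔ x}`). [cite: FitznerVanDerHofstad2017, §4.2 (4.1) (arXiv:1506.07977v2 p. 34)] -/
theorem tauGe_zero_eq_tau (p : unitInterval) (x : Site d) : tauGe d p 0 x = tau d p 0 x := by
  unfold tauGe
  rw [openConnGe_zero]
  rfl

/-- `τ_{m,p}` is decreasing in `m`. [folklore] -/
theorem tauGe_anti (p : unitInterval) {m m' : ℕ} (h : m ≤ m') (x : Site d) : tauGe d p m' x ≤ tauGe d p m x :=
  measureReal_mono (openConnGe_anti h 0 x)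

/-- `τ_{m,p}(x) ≤ τ_p(x)`. [cite: FitznerVanDerHofstad2017, §4.2 (4.1) (arXiv:1506.07977v2 p. 34)] -/
theorem tauGe_le_tau (p : unitInterval) (m : ℕ) (x : Site d) : tauGe d p m x ≤ tau d p 0 x := by
  rw [← tauGe_zero_eq_tau]
  exact tauGe_anti p (Nat.zero_le m) x

/-- `τ_{m,p}` is summable below `p_c`. [folklore] -/
theorem summable_tauGe (hd : 2 ≤ d) (p : unitInterval) (hp : p < criticalProbI d) (m : ℕ) :
    Summable (tauGe d p m) := by
  have hp' : (p : ℝ) < criticalProb (zdGraph d) (0 : Site d) := hp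
  exact (summable_tau_of_lt_criticalProb hd p hp').of_nonneg_of_le (tauGe_nonneg p m) (tauGe_le_tau p m)

/-! ### B. The first bond of an open path: `{v ←m+1→ x} ⊆ ⋃_y {(v,y) open} □ {y ←m→ x}` -/

section FirstBond

variable {V : Type*}

/-- **First-bond decomposition.** If `{v ←m+1→ x}` occurs then for some `y` the bond `(v, y)` is open and
`{(v,y) open} □ {y ←m→ x}` occurs (the tail of the simple path is an open simple path of length `≥ m` from
`y` to `x` not using the bond `(v, y)`). [cite: FitznerVanDerHofstad2017, §4.2 (4.3) (arXiv:1506.07977v2 p. 34)] -/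
theorem exists_first_bond_of_mem_openConnGe {ω : BondConfig V} {m : ℕ} {v x : V}
    (h : ω ∈ openConnGe (m + 1) v x) :
    ∃ y, s(v, y) ∈ ω ∧ ω ∈ {ω' : BondConfig V | s(v, y) ∈ ω'} □ openConnGe m y x := by
  obtain ⟨w, hw, hm⟩ := h
  cases w with
  | nil => simp at hm
  | cons hadj q =>
    rename_i y
    have hvy : s(v, y) ∈ ω ∧ v ≠ y := by
      have h := hadj
      simp only [openGraph, SimpleGraph.fromEdgeSet_adj] at h
      exact h
    rw [SimpleGraph.Walk.cons_isPath_iff] at hw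
    have hlen : m ≤ q.length := by
      rw [SimpleGraph.Walk.length_cons] at hm
      omega
    have hnot : s(v, y) ∉ q.edges := fun he => hw.2 (q.fst_mem_support_of_mem_edges he)
    refine ⟨y, hvy.1, ?_⟩
    rw [(isUpperSet_mem_bond (s(v, y))).mem_disjointOccurrence_iff (isUpperSet_openConnGe m y x)]
    refine ⟨{s(v, y)}, by simpa using hvy.1, {e | e ∈ q.edges}, fun e he => mem_of_mem_walk_edges q he,
      ?_, by simp, ?_⟩
    · exact Set.disjoint_left.2 fun e he heq => hnot (by rw [Set.mem_singleton_iff] at he; exact he ▸ heq)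
    · exact mem_openConnGe_of_walk q hw.1 hlen fun e he => he

end FirstBond

/-! ### C. (4.3): `τ_{m+1,p}(x) ≤ 2dp (D ⋆ τ_{m,p})(x)` and `τ_{m,p}(x) ≤ (2dp)^m (D^{⋆m} ⋆ τ_p)(x)` -/

/-- The convolution with the SRW step is the average over the `2d` neighbours:
`(D ⋆ g)(x) = (2d)^{-1} Σ_{y ∼ 0} g(x − y)`. [folklore] -/
theorem srwStep_latticeConv_eq_sum (g : Site d → ℝ) (x : Site d) :
    latticeConv (srwStep d) g x = 1 / (2 * d) * ∑ y ∈ (zdGraph d).neighborFinset 0, g (x - y) := by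
  show ∑' y, srwStep d y * g (x - y) = _
  rw [tsum_eq_sum (s := (zdGraph d).neighborFinset 0)
    (fun y hy => by rw [SpreadOutIsing.srwStep_of_not_mem hy, zero_mul]), Finset.mul_sum]
  refine Finset.sum_congr rfl fun y hy => ?_
  rw [show srwStep d y = 1 / (2 * d) from if_pos ((SimpleGraph.mem_neighborFinset _ _ _).1 hy)]

/-- **[FvdH17] (4.3), first step**: `τ_{m+1,p}(x) ≤ 2dp · (D ⋆ τ_{m,p})(x)` for all `m ≥ 0` and all `x`
(BK on the first bond of the path). [cite: FitznerVanDerHofstad2017, §4.2 (4.3) (arXiv:1506.07977v2 p. 34; EJP 22 (2017) no. 43 p. 31)] -/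
theorem tauGe_succ_le_srwStep_conv (hd : 1 ≤ d) (p : unitInterval) (m : ℕ) (x : Site d) :
    tauGe d p (m + 1) x ≤ 2 * d * (p : ℝ) * latticeConv (srwStep d) (tauGe d p m) x := by
  classical
  have hd' : (d : ℝ) ≠ 0 := by exact_mod_cast (show d ≠ 0 by omega)
  -- a.e. every configuration lies in the edge set of `ℤ^d`, so the first bond goes to a lattice neighbour
  have hae : ∀ᵐ ω ∂(bondPercolation (zdGraph d) p), ω ∈ openConnGe (m + 1) (0 : Site d) x →
      ω ∈ ⋃ y ∈ (zdGraph d).neighborFinset (0 : Site d),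
        ({ω' : BondConfig (Site d) | s((0 : Site d), y) ∈ ω'} □ openConnGe m y x) := by
    filter_upwards [(ProbabilityTheory.setBernoulli_ae_subset :
      ∀ᵐ ω ∂(bondPercolation (zdGraph d) p), ω ⊆ (zdGraph d).edgeSet)] with ω hωE hω
    obtain ⟨y, hy, hmem⟩ := exists_first_bond_of_mem_openConnGe hω
    have hadj : (zdGraph d).Adj 0 y := by
      have := hωE hy
      rwa [SimpleGraph.mem_edgeSet] at this
    exact Set.mem_iUnion₂.2 ⟨y, (SimpleGraph.mem_neighborFinset _ _ _).2 hadj, hmem⟩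
  have h1 : (bondPercolation (zdGraph d) p).real (openConnGe (m + 1) (0 : Site d) x) ≤
      (bondPercolation (zdGraph d) p).real (⋃ y ∈ (zdGraph d).neighborFinset (0 : Site d),
        ({ω' : BondConfig (Site d) | s((0 : Site d), y) ∈ ω'} □ openConnGe m y x)) := by
    simp only [measureReal_def]
    exact ENNReal.toReal_mono (measure_ne_top _ _) (measure_mono_ae hae)
  have h2 := measureReal_biUnion_finset_le (μ := bondPercolation (zdGraph d) p)
    ((zdGraph d).neighborFinset (0 : Site d))
    (fun y => ({ω' : BondConfig (Site d) | s((0 : Site d), y) ∈ ω'} □ openConnGe m y x))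
  have h3 : ∀ y ∈ (zdGraph d).neighborFinset (0 : Site d),
      (bondPercolation (zdGraph d) p).real ({ω' : BondConfig (Site d) | s((0 : Site d), y) ∈ ω'} □ openConnGe m y x)
        ≤ (p : ℝ) * tauGe d p m (x - y) := by
    intro y hy
    have hadj : (zdGraph d).Adj 0 y := (SimpleGraph.mem_neighborFinset _ _ _).1 hy
    calc (bondPercolation (zdGraph d) p).real
          ({ω' : BondConfig (Site d) | s((0 : Site d), y) ∈ ω'} □ openConnGe m y x)
        ≤ (bondPercolation (zdGraph d) p).real {ω' : BondConfig (Site d) | s((0 : Site d), y) ∈ ω'} *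
            (bondPercolation (zdGraph d) p).real (openConnGe m y x) :=
          bk_finitary (zdGraph d) p (isUpperSet_mem_bond _) (isUpperSet_openConnGe m y x)
            (isFinitary_mem_bond _) (isFinitary_openConnGe m y x)
      _ = (p : ℝ) * tauGe d p m (x - y) := by
          rw [bondPercolation_cylinder (zdGraph d) p ((SimpleGraph.mem_edgeSet _).2 hadj),
            measureReal_openConnGe_eq_tauGe]
  have h4 : ∑ y ∈ (zdGraph d).neighborFinset (0 : Site d), (p : ℝ) * tauGe d p m (x - y) =
      2 * d * (p : ℝ) * latticeConv (srwStep d) (tauGe d p m) x := by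
    rw [srwStep_latticeConv_eq_sum, ← Finset.mul_sum, ← mul_assoc,
      show 2 * (d : ℝ) * (p : ℝ) * (1 / (2 * d)) = (p : ℝ) by field_simp]
  calc tauGe d p (m + 1) x = (bondPercolation (zdGraph d) p).real (openConnGe (m + 1) (0 : Site d) x) := rfl
    _ ≤ ∑ y ∈ (zdGraph d).neighborFinset (0 : Site d), (bondPercolation (zdGraph d) p).real
          ({ω' : BondConfig (Site d) | s((0 : Site d), y) ∈ ω'} □ openConnGe m y x) := h1.trans h2
    _ ≤ ∑ y ∈ (zdGraph d).neighborFinset (0 : Site d), (p : ℝ) * tauGe d p m (x - y) := Finset.sum_le_sum h3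
    _ = 2 * d * (p : ℝ) * latticeConv (srwStep d) (tauGe d p m) x := h4

/-- Scalars pull out of the first factor of a convolution. [folklore] -/
theorem latticeConv_const_mul_left (f g : Site d → ℝ) (c : ℝ) (x : Site d) :
    latticeConv (fun y => c * f y) g x = c * latticeConv f g x := by
  show ∑' y, c * f y * g (x - y) = c * ∑' y, f y * g (x - y)
  rw [← tsum_mul_left]
  exact tsum_congr fun y => by ring

/-! ### D. Convolution algebra of `ℓ¹ ∩ ℓ^∞` kernels -/

section Algebra

variable {u v w z : Site d → ℝ}

/-- **Interchange `(u ⋆ v) ⋆ (w ⋆ z) = (u ⋆ w) ⋆ (v ⋆ z)`** for `u, v, w ∈ ℓ¹` and `z` bounded.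
[folklore] -/
theorem latticeConv_latticeConv_comm₄ (hu : Summable fun x => |u x|) (hv : Summable fun x => |v x|)
    (hw : Summable fun x => |w x|) {Mz : ℝ} (hMz : ∀ x, |z x| ≤ Mz) (x : Site d) :
    latticeConv (latticeConv u v) (latticeConv w z) x = latticeConv (latticeConv u w) (latticeConv v z) x := by
  have hwz : ∀ y, |latticeConv w z y| ≤ (∑' y, |w y|) * Mz := fun y => abs_latticeConv_le_of_bdd hw hMz y
  have hvz : ∀ y, |latticeConv v z y| ≤ (∑' y, |v y|) * Mz := fun y => abs_latticeConv_le_of_bdd hv hMz y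
  -- inner interchange `v ⋆ (w ⋆ z) = w ⋆ (v ⋆ z)`
  have hinner : latticeConv v (latticeConv w z) = latticeConv w (latticeConv v z) := by
    funext y
    rw [← latticeConv_assoc_of_bdd hv hw hMz y, ← latticeConv_assoc_of_bdd hw hv hMz y]
    congr 1
    exact funext fun t => latticeConv_comm v w t
  rw [latticeConv_assoc_of_bdd hu hv hwz x, hinner, ← latticeConv_assoc_of_bdd hu hw hvz x]

end Algebra

/-! ### E. The non-repulsive diagrams (4.5)–(4.8) summed over all but the last vertex -/

/-- **The summed non-repulsive diagram with lower indices `[l₁, …, l_n]`**: the iterated convolution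
`τ_{l₁,p} ⋆ (τ_{l₂,p} ⋆ ( ⋯ ⋆ (τ_{l_n,p} ⋆ δ₀)))`, i.e. [FvdH17] (4.5)–(4.8)
`𝓑*_{l₁,l₂}(x₁,x₂) = τ_{l₁}(x₁)τ_{l₂}(x₂−x₁)`, `𝓣* = 𝓑* τ_{l₃}(x₃−x₂)`, `𝓢*`, `𝓟*` summed over
`x₁, …, x_{n−1}` as a function of the last vertex (`nonRepDiagram_pair_eq_tsum`,
`nonRepDiagram_triple_eq_tsum`); lower indices only (no `underline` indices).
[cite: FitznerVanDerHofstad2017, §4.2 (4.5)–(4.8) (arXiv:1506.07977v2 p. 34)] -/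
def nonRepDiagram (d : ℕ) (p : unitInterval) : List ℕ → Site d → ℝ
  | [] => delta0
  | l :: ls => latticeConv (tauGe d p l) (nonRepDiagram d p ls)

/-- Unfolding, empty list. [folklore] -/
theorem nonRepDiagram_nil (p : unitInterval) : nonRepDiagram d p [] = delta0 := rfl

/-- Unfolding, `l :: ls`. [folklore] -/
theorem nonRepDiagram_cons (p : unitInterval) (l : ℕ) (ls : List ℕ) :
    nonRepDiagram d p (l :: ls) = latticeConv (tauGe d p l) (nonRepDiagram d p ls) := rfl

/-- One index: `nonRepDiagram [l] = τ_{l,p}`. [folklore] -/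
theorem nonRepDiagram_singleton (p : unitInterval) (l : ℕ) : nonRepDiagram d p [l] = tauGe d p l :=
  funext fun x => by rw [nonRepDiagram_cons, nonRepDiagram_nil, latticeConv_delta0]

/-- **`Σ_{x₁} 𝓑*_{l₁,l₂}(x₁,x₂) = Σ_{x₁} τ_{l₁}(x₁) τ_{l₂}(x₂ − x₁)`** ([FvdH17] (4.5) summed over `x₁`).
[cite: FitznerVanDerHofstad2017, §4.2 (4.5) (arXiv:1506.07977v2 p. 34)] -/
theorem nonRepDiagram_pair_eq_tsum (p : unitInterval) (l₁ l₂ : ℕ) (x₂ : Site d) :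
    nonRepDiagram d p [l₁, l₂] x₂ = ∑' x₁, tauGe d p l₁ x₁ * tauGe d p l₂ (x₂ - x₁) := by
  rw [nonRepDiagram_cons, nonRepDiagram_singleton]
  rfl

/-- **`Σ_{x₁,x₂} 𝓣*_{l₁,l₂,l₃}(x₁,x₂,x₃) = Σ_{x₁} τ_{l₁}(x₁) Σ_{x₂} τ_{l₂}(x₂ − x₁) τ_{l₃}(x₃ − x₂)`**
([FvdH17] (4.6) summed over `x₁, x₂`, as an iterated sum). [cite: FitznerVanDerHofstad2017, §4.2 (4.6), (4.10) (arXiv:1506.07977v2 pp. 34–35)] -/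
theorem nonRepDiagram_triple_eq_tsum (p : unitInterval) (l₁ l₂ l₃ : ℕ) (x₃ : Site d) :
    nonRepDiagram d p [l₁, l₂, l₃] x₃ =
      ∑' x₁, tauGe d p l₁ x₁ * ∑' x₂, tauGe d p l₂ (x₂ - x₁) * tauGe d p l₃ (x₃ - x₂) := by
  rw [nonRepDiagram_cons, nonRepDiagram_cons, nonRepDiagram_singleton]
  have hshift : ∀ x₁ : Site d, ∑' x₂, tauGe d p l₂ (x₂ - x₁) * tauGe d p l₃ (x₃ - x₂) =
      ∑' y, tauGe d p l₂ y * tauGe d p l₃ (x₃ - x₁ - y) := fun x₁ => by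
    rw [← (Equiv.subRight x₁).tsum_eq (fun y => tauGe d p l₂ y * tauGe d p l₃ (x₃ - x₁ - y))]
    refine tsum_congr fun x₂ => ?_
    simp only [Equiv.subRight_apply, sub_sub_sub_cancel_right]
  show ∑' x₁, tauGe d p l₁ x₁ * (∑' y, tauGe d p l₂ y * tauGe d p l₃ (x₃ - x₁ - y)) = _
  exact tsum_congr fun x₁ => by rw [hshift x₁]

/-- `nonRepDiagram ≥ 0`. [folklore] -/
theorem nonRepDiagram_nonneg (p : unitInterval) : ∀ (ls : List ℕ) (x : Site d), 0 ≤ nonRepDiagram d p ls x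
  | [], x => SpreadOutIsing.delta0_nonneg x
  | l :: ls, x => latticeConv_nonneg (tauGe_nonneg p l) (nonRepDiagram_nonneg p ls) x

/-- `nonRepDiagram` is summable below `p_c`. [folklore] -/
theorem summable_nonRepDiagram (hd : 2 ≤ d) (p : unitInterval) (hp : p < criticalProbI d) :
    ∀ ls : List ℕ, Summable (nonRepDiagram d p ls)
  | [] => hasSum_delta0.summable
  | l :: ls => summable_latticeConv (summable_tauGe hd p hp l) (summable_nonRepDiagram hd p hp ls)
      (tauGe_nonneg p l) (nonRepDiagram_nonneg p ls)

/-- `τ_p ⋆ τ_p^{⋆n} = τ_p^{⋆(n+1)}`. [folklore] -/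
theorem tau_latticeConv_convPow_tau (p : unitInterval) (n : ℕ) :
    latticeConv (tau d p 0) (convPow (tau d p 0) n) = convPow (tau d p 0) (n + 1) :=
  funext fun y => by rw [latticeConv_comm]; rfl

/-- **[FvdH17] (4.10), first inequality / [NoBLE17] §5.3.2 first display, first inequality** (`x`-space):
`(τ_{l₁,p} ⋆ ⋯ ⋆ τ_{l_n,p})(x) ≤ (2dp)^{l} (D^{⋆l} ⋆ τ_p^{⋆n})(x)` with `l = Σᵢ lᵢ`, for every list of
lower indices, every `x`, `p < p_c`, `d ≥ 2`. [cite: FitznerVanDerHofstad2017, §4.2 (4.10) (arXiv:1506.07977v2 p. 35; EJP 22 (2017) no. 43 p. 32)] -/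
theorem nonRepDiagram_le_pow_mul_srwConvTau (hd : 2 ≤ d) (p : unitInterval) (hp : p < criticalProbI d) :
    ∀ (ls : List ℕ) (x : Site d), nonRepDiagram d p ls x ≤
      (2 * d * (p : ℝ)) ^ ls.sum * latticeConv (convPow (srwStep d) ls.sum) (convPow (tau d p 0) ls.length) x
  | [], x => by
    rw [List.sum_nil, List.length_nil, pow_zero, one_mul]
    show delta0 x ≤ latticeConv delta0 delta0 x
    rw [latticeConv_delta0_left]
  | l :: ls, x => by
    have hp' : (p : ℝ) < criticalProb (zdGraph d) (0 : Site d) := hp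
    have hτs : Summable fun y => tau d p 0 y := summable_tau_of_lt_criticalProb hd p hp'
    have hτn : ∀ n, Summable (convPow (tau d p 0) n) := fun n => summable_convPow_of_summable hτs (tau_nonneg p 0) n
    have hτn0 : ∀ n y, 0 ≤ convPow (tau d p 0) n y := fun n => convPow_nonneg_of_nonneg (tau_nonneg p 0) n
    set c : ℝ := 2 * d * (p : ℝ) with hc
    have hc0 : 0 ≤ c := mul_nonneg (mul_nonneg zero_le_two (Nat.cast_nonneg d)) p.2.1
    set S := ls.sum with hS
    set n := ls.length with hn
    have ih : ∀ y, nonRepDiagram d p ls y ≤ c ^ S * latticeConv (convPow (srwStep d) S) (convPow (tau d p 0) n) y :=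
      fun y => nonRepDiagram_le_pow_mul_srwConvTau hd p hp ls y
    have h1 : ∀ y, tauGe d p l y ≤ c ^ l * latticeConv (convPow (srwStep d) l) (tau d p 0) y :=
      fun y => tauGe_le_pow_mul_srwConv_tau p l y
    -- summability of the two majorants
    have hA : Summable fun y => c ^ l * latticeConv (convPow (srwStep d) l) (tau d p 0) y :=
      (summable_latticeConv (summable_convPow_srwStep l) hτs (convPow_srwStep_nonneg l) (tau_nonneg p 0)).mul_left _
    have hB : Summable fun y => c ^ S * latticeConv (convPow (srwStep d) S) (convPow (tau d p 0) n) y :=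
      (summable_latticeConv (summable_convPow_srwStep S) (hτn n) (convPow_srwStep_nonneg S) (hτn0 n)).mul_left _
    -- the interchange `(D^l ⋆ τ) ⋆ (D^S ⋆ τ^n) = (D^l ⋆ D^S) ⋆ (τ ⋆ τ^n) = D^{l+S} ⋆ τ^{n+1}`
    have hM : ∀ y, |convPow (tau d p 0) n y| ≤ (∑' y, |tau d p 0 y|) ^ n :=
      SpreadOutIsing.abs_convPow_le hτs.abs n
    have hswap : latticeConv (latticeConv (convPow (srwStep d) l) (tau d p 0))
        (latticeConv (convPow (srwStep d) S) (convPow (tau d p 0) n)) x =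
        latticeConv (convPow (srwStep d) (l + S)) (convPow (tau d p 0) (n + 1)) x := by
      rw [latticeConv_latticeConv_comm₄ ((summable_convPow_srwStep l).abs) hτs.abs ((summable_convPow_srwStep S).abs)
        hM x, tau_latticeConv_convPow_tau]
      have hDD : latticeConv (convPow (srwStep d) l) (convPow (srwStep d) S) = convPow (srwStep d) (l + S) :=
        funext fun y => convPow_srwStep_add_apply l S y
      rw [hDD]
    calc nonRepDiagram d p (l :: ls) x = latticeConv (tauGe d p l) (nonRepDiagram d p ls) x := rfl
      _ ≤ latticeConv (fun y => c ^ l * latticeConv (convPow (srwStep d) l) (tau d p 0) y)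
            (fun y => c ^ S * latticeConv (convPow (srwStep d) S) (convPow (tau d p 0) n) y) x :=
          latticeConv_mono hA hB (tauGe_nonneg p l) (nonRepDiagram_nonneg p ls) h1 ih x
      _ = c ^ (l + S) * latticeConv (convPow (srwStep d) (l + S)) (convPow (tau d p 0) (n + 1)) x := by
          rw [latticeConv_const_mul_left (latticeConv (convPow (srwStep d) l) (tau d p 0)) _ (c ^ l),
            latticeConv_const_mul_right (c ^ S) (latticeConv (convPow (srwStep d) l) (tau d p 0))
              (latticeConv (convPow (srwStep d) S) (convPow (tau d p 0) n)), hswap, pow_add]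
          ring
      _ = c ^ (l :: ls).sum * latticeConv (convPow (srwStep d) (l :: ls).sum)
            (convPow (tau d p 0) (l :: ls).length) x := by
          rw [List.sum_cons, List.length_cons]

/-- The bubble case `n = 2` of `nonRepDiagram_le_pow_mul_srwConvTau`, unfolded:
`Σ_{x₁} τ_{l₁}(x₁) τ_{l₂}(x − x₁) ≤ (2dp)^{l₁+l₂} (D^{⋆(l₁+l₂)} ⋆ τ_p^{⋆2})(x)`.
[cite: FitznerVanDerHofstad2017, §4.2 (4.5), (4.10) (arXiv:1506.07977v2 pp. 34–35)] -/
theorem bubbleStar_le_pow_mul_srwConvTau (hd : 2 ≤ d) (p : unitInterval) (hp : p < criticalProbI d)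
    (l₁ l₂ : ℕ) (x : Site d) :
    ∑' x₁, tauGe d p l₁ x₁ * tauGe d p l₂ (x - x₁) ≤
      (2 * d * (p : ℝ)) ^ (l₁ + l₂) * latticeConv (convPow (srwStep d) (l₁ + l₂)) (convPow (tau d p 0) 2) x := by
  have h := nonRepDiagram_le_pow_mul_srwConvTau hd p hp [l₁, l₂] x
  rw [nonRepDiagram_pair_eq_tsum] at h
  simpa using h

/-! ### F. Assembly with the `k`-space half: the `K_{n,l}(x)` bounds -/

/-- **[NoBLE17] §5.3.2 first display, complete for percolation's non-repulsive diagrams**: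
`(τ_{l₁,p} ⋆ ⋯ ⋆ τ_{l_n,p})(x) ≤ (2dp)^l · Γ̄₂ⁿ · K_{n,l}(x)`, `l = Σ lᵢ`, `Γ̄₂ = sup_k [1−D̂(k)]|τ̂_p(k)|`
(`nobleSup2`), for `2n + 1 ≤ d`, `p < p_c`. [cite: FitznerVanDerHofstad2016NoBLE, §5.3.2 first display (PTRF 169 (2017) p. 1097)] -/
theorem nonRepDiagram_le_srwK {ls : List ℕ} (hn : 2 * ls.length + 1 ≤ d) (hd : 2 ≤ d) (p : unitInterval)
    (hp : p < criticalProbI d) (x : Site d) :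
    nonRepDiagram d p ls x ≤
      (2 * d * (p : ℝ)) ^ ls.sum * (nobleSup2 d p ^ ls.length * srwK d ls.length ls.sum x) := by
  refine (nonRepDiagram_le_pow_mul_srwConvTau hd p hp ls x).trans ?_
  exact mul_le_mul_of_nonneg_left (srwConvTau_le_nobleSup2_pow_mul_srwK hn hd p hp ls.sum x)
    (pow_nonneg (mul_nonneg (mul_nonneg zero_le_two (Nat.cast_nonneg d)) p.2.1) _)

/-- **[FvdH17] (4.10)–(4.11) / [NoBLE17] §5.3.2 first display, printed constants**:
`(τ_{l₁,p} ⋆ ⋯ ⋆ τ_{l_n,p})(x) ≤ ((2d/(2d−1))Γ₁)^l (((2d−2)/(2d−1))Γ₂)ⁿ K_{n,l}(x)` under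
`(2d−1)p ≤ Γ₁` and `f₂(p) ≤ Γ₂` (`2n + 1 ≤ d`, `p < p_c`). [cite: FitznerVanDerHofstad2017, §4.2 (4.10)–(4.11) (arXiv:1506.07977v2 p. 35; EJP 22 (2017) no. 43 p. 32)] -/
theorem nonRepDiagram_le_printed {ls : List ℕ} (hn : 2 * ls.length + 1 ≤ d) (hd : 2 ≤ d) (p : unitInterval)
    (hp : p < criticalProbI d) {Γ₁ Γ₂ : ℝ} (hΓ1 : (2 * d - 1) * (p : ℝ) ≤ Γ₁) (hΓ2 : nobleF2 d p ≤ Γ₂)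
    (x : Site d) :
    nonRepDiagram d p ls x ≤
      (2 * d / (2 * d - 1) * Γ₁) ^ ls.sum * ((2 * d - 2) / (2 * d - 1) * Γ₂) ^ ls.length *
        srwK d ls.length ls.sum x :=
  (nonRepDiagram_le_pow_mul_srwConvTau hd p hp ls x).trans (srwConvTau_le_printed hn hd p hp hΓ1 hΓ2 ls.sum x)

/-- The same with the bootstrap function `f₁(p) ≤ Γ₁` ([FvdH17] (2.19)) as hypothesis.
[cite: FitznerVanDerHofstad2017, §4.2 (4.10)–(4.11) (arXiv:1506.07977v2 p. 35)] -/
theorem nonRepDiagram_le_printed_of_nobleF1_le {ls : List ℕ} (hn : 2 * ls.length + 1 ≤ d) (hd : 2 ≤ d)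
    (p : unitInterval) (hp : p < criticalProbI d) {cμ Γ₁ Γ₂ : ℝ} (hΓ1 : nobleF1 d cμ p ≤ Γ₁)
    (hΓ2 : nobleF2 d p ≤ Γ₂) (x : Site d) :
    nonRepDiagram d p ls x ≤
      (2 * d / (2 * d - 1) * Γ₁) ^ ls.sum * ((2 * d - 2) / (2 * d - 1) * Γ₂) ^ ls.length *
        srwK d ls.length ls.sum x :=
  (nonRepDiagram_le_pow_mul_srwConvTau hd p hp ls x).trans
    (srwConvTau_le_printed_of_nobleF1_le hn hd p hp hΓ1 hΓ2 ls.sum x)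

/-- **The modified two-point function itself** (`n = 1`): `τ_{m,p}(x) ≤ (2dp)^m Γ̄₂ K_{1,m}(x)` (`d ≥ 3`).
[cite: FitznerVanDerHofstad2016NoBLE, §5.3.2 first display (PTRF 169 (2017) p. 1097)] -/
theorem tauGe_le_srwK (hd : 3 ≤ d) (p : unitInterval) (hp : p < criticalProbI d) (m : ℕ) (x : Site d) :
    tauGe d p m x ≤ (2 * d * (p : ℝ)) ^ m * (nobleSup2 d p * srwK d 1 m x) := by
  have hd2 : 2 ≤ d := by omega
  refine (tauGe_le_pow_mul_srwConv_tau p m x).trans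
    (mul_le_mul_of_nonneg_left ?_ (pow_nonneg (mul_nonneg (mul_nonneg zero_le_two (Nat.cast_nonneg d)) p.2.1) _))
  have h := srwConvTau_le_nobleSup2_pow_mul_srwK (n := 1) (by omega) hd2 p hp m x
  rw [pow_one] at h
  rwa [SpreadOutIsing.convPow_one_eq] at h

end Literature.Probability.FitznerVanDerHofstad2017

end
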